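import Literature.NumberTheory.GelbartRogawski1991.DoubledUnitaryGlobalSplittingData
import HarnessLib

/-!
# Place components of `P_Δ`, `det_Δ`, `χ(det_Δ)`, `|det_Δ|^{1/2}` at `ι_v u = locToAdelic v u`

[GelbartRogawski1991, §3.1 Prop. 3.1.1] by doubling, bookkeeping between the ADELIC prescription of
`DoubledUnitaryGlobalSplittingData` (`IsDoubledWeilRep`, `ParabolicNormalisedAt v` — stated at the adelic element
`locToAdelic v u`) and the LOCAL data at the places `w ∣ v` of `L` used by the per-place package
(`LocalDoubledUnitaryDatum`: `LocalSplitting.detDelta ∕ deltaBlock ∕ chiDet`).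

Matrix level: `IsSiegelM M :↔ M₁₁ + M₁₂ = M₂₁ + M₂₂`, `detDeltaM M := det (M₁₁ + M₁₂)` (blocks via
`e₂ = finSumFinEquiv`), so that `IsSiegelDelta h ↔ IsSiegelM (matrix of h)` and `detDelta h = detDeltaM (matrix of h)`
DEFINITIONALLY.  Results (`ι_v u := locToAdelic v u = finAdelicToAdelic (inclPlace v u)`, tree
`UnitaryGroupPlaceInclusion`):
* `isSiegelDelta_locToAdelic_iff : ι_v u ∈ P_Δ(𝔸) ↔ ∀ w ∣ v, IsSiegelM (M(u,w))`;
* `(det_Δ ι_v u).1 = 1`, `(det_Δ ι_v u).2 w = detDeltaM (M(u,⟨w,h⟩))` if `h : w ∣ v`, `= 1` otherwise;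
* `isUnit_detDelta_locToAdelic_iff : det_Δ(ι_v u) ∈ 𝔸_L^× ↔ ∀ w ∣ v, detDeltaM (M(u,w)) ∈ L_w^×`, the unit being
  the idele `detDeltaIdele v u _ := ∏_{w ∣ v} localUnits w (det_Δ u_w)`;
* `chiDet_locToAdelic : χ(det_Δ ι_v u) = ∏_{w ∣ v} χ_w(det_Δ u_w)`, `χ_w := HeckeCharacter.localComponent χ w`;
* `modDelta_locToAdelic : |det_Δ ι_v u|_𝔸^{1/2} = ∏_{w ∣ v} ‖det_Δ u_w‖_w^{1/2}`.
-/

set_option autoImplicit false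

noncomputable section

open scoped Classical
open scoped Matrix Kronecker TensorProduct
open NumberField IsDedekindDomain
open Literature.RepresentationTheory.HeisenbergGroup
open Literature.NumberTheory.Automorphic
open Literature.NumberTheory.Weil1964
open Literature.RepresentationTheory.HarrisKudlaSweet1996
open Literature.NumberTheory.GaloisRepresentations

namespace Literature.NumberTheory.GelbartRogawski1991.GRConstruction

open UnitaryDualPair

variable (L : Type) [Field L] [NumberField L] [IsCMField L]

variable {N M n : ℕ} (e : Fin N × Fin M ≃ Fin n)
  (dV : Fin N → L) (hdV : ∀ i, IsCMField.complexConj L (dV i) = dV i) (hdV0 : ∀ i, dV i ≠ 0)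
  (dW : Fin M → L) (hdW : ∀ i, IsCMField.complexConj L (dW i) = dW i) (hdW0 : ∀ i, dW i ≠ 0)

section PlaceComponents

local notation "LocPi" => UnitaryGroup.localPi L (IsCMField.complexConj L) (n + n) (hermD L e dV hdV dW hdW)
local notation "LocGLPi" => UnitaryGroup.LocalGLPi L (n + n)
local notation "HAf" => UnitaryGroup.finAdelic (Fp L) L (IsCMField.complexConj L) (n + n) (hermD L e dV hdV dW hdW)
local notation "finToA" => UnitaryGroup.finAdelicToAdelic (Fp L) L (IsCMField.complexConj L) (n + n) (hermD L e dV hdV dW hdW)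
local notation "inclP" => UnitaryGroup.inclPlace (Fp L) L (IsCMField.complexConj L) (n + n) (hermD L e dV hdV dW hdW)

/-! ##### matrix level -/

/-- `M ∈ P_Δ`: `M₁₁ + M₁₂ = M₂₁ + M₂₂` (blocks of `M` in the enumeration `Fin n ⊕ Fin n ≃ Fin (n + n)`, `e₂`).
[cite: GelbartRogawski1991, §3.1 Prop. 3.1.1 p. 455 L1–2] -/
def IsSiegelM {R : Type*} [Add R] (M : Matrix (Fin (n + n)) (Fin (n + n)) R) : Prop :=
  (Matrix.reindex (e₂ (n := n)).symm (e₂ (n := n)).symm M).toBlocks₁₁ +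
      (Matrix.reindex (e₂ (n := n)).symm (e₂ (n := n)).symm M).toBlocks₁₂ =
    (Matrix.reindex (e₂ (n := n)).symm (e₂ (n := n)).symm M).toBlocks₂₁ +
      (Matrix.reindex (e₂ (n := n)).symm (e₂ (n := n)).symm M).toBlocks₂₂

/-- `det_Δ M := det (M₁₁ + M₁₂)`. [cite: GelbartRogawski1991, §3.1 Prop. 3.1.1 p. 455 L1–2] -/
def detDeltaM {R : Type*} [CommRing R] (M : Matrix (Fin (n + n)) (Fin (n + n)) R) : R :=
  ((Matrix.reindex (e₂ (n := n)).symm (e₂ (n := n)).symm M).toBlocks₁₁ +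
    (Matrix.reindex (e₂ (n := n)).symm (e₂ (n := n)).symm M).toBlocks₁₂).det

/-- `IsSiegelDelta h` IS the Siegel relation of the matrix of `h` (definitional).
[cite: GelbartRogawski1991, §3.1 Prop. 3.1.1 p. 455 L1–2] -/
theorem isSiegelDelta_iff_isSiegelM (h : HA L e dV hdV dW hdW) :
    IsSiegelDelta L e dV hdV dW hdW h ↔
      IsSiegelM ((h : GL (Fin (n + n)) (AdeleRing (𝓞 L) L)) : Matrix (Fin (n + n)) (Fin (n + n)) (AdeleRing (𝓞 L) L)) :=
  Iff.rfl

/-- `detDelta h` IS `detDeltaM` of the matrix of `h` (definitional).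
[cite: GelbartRogawski1991, §3.1 Prop. 3.1.1 p. 455 L1–2] -/
theorem detDelta_eq_detDeltaM (h : HA L e dV hdV dW hdW) :
    detDelta L e dV hdV dW hdW h =
      detDeltaM ((h : GL (Fin (n + n)) (AdeleRing (𝓞 L) L)) : Matrix (Fin (n + n)) (Fin (n + n)) (AdeleRing (𝓞 L) L)) :=
  rfl

/-- entrywise form of the Siegel relation (as `isSiegelDelta_iff_entry`).
[cite: GelbartRogawski1991, §3.1 Prop. 3.1.1 p. 455 L1–2] -/
theorem isSiegelM_iff_entry {R : Type*} [Add R] (M : Matrix (Fin (n + n)) (Fin (n + n)) R) :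
    IsSiegelM M ↔ ∀ i j : Fin n,
      M (e₂ (Sum.inl i)) (e₂ (Sum.inl j)) + M (e₂ (Sum.inl i)) (e₂ (Sum.inr j)) =
        M (e₂ (Sum.inr i)) (e₂ (Sum.inl j)) + M (e₂ (Sum.inr i)) (e₂ (Sum.inr j)) := by
  unfold IsSiegelM
  rw [← Matrix.ext_iff]
  simp only [Matrix.add_apply, Matrix.toBlocks₁₁, Matrix.toBlocks₁₂, Matrix.toBlocks₂₁, Matrix.toBlocks₂₂,
    Matrix.of_apply, Matrix.reindex_apply, Matrix.submatrix_apply, Equiv.symm_symm]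

/-- the four `e₂`-blocks commute with entrywise maps (definitional).
[cite: GelbartRogawski1991, §3.1 Prop. 3.1.1 p. 455 L1–2] -/
theorem toBlocks_reindex_e₂_map {R S : Type*} (f : R → S) (M : Matrix (Fin (n + n)) (Fin (n + n)) R) :
    (Matrix.reindex (e₂ (n := n)).symm (e₂ (n := n)).symm (M.map f)).toBlocks₁₁ =
        ((Matrix.reindex (e₂ (n := n)).symm (e₂ (n := n)).symm M).toBlocks₁₁).map f ∧
      (Matrix.reindex (e₂ (n := n)).symm (e₂ (n := n)).symm (M.map f)).toBlocks₁₂ =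
        ((Matrix.reindex (e₂ (n := n)).symm (e₂ (n := n)).symm M).toBlocks₁₂).map f ∧
      (Matrix.reindex (e₂ (n := n)).symm (e₂ (n := n)).symm (M.map f)).toBlocks₂₁ =
        ((Matrix.reindex (e₂ (n := n)).symm (e₂ (n := n)).symm M).toBlocks₂₁).map f ∧
      (Matrix.reindex (e₂ (n := n)).symm (e₂ (n := n)).symm (M.map f)).toBlocks₂₂ =
        ((Matrix.reindex (e₂ (n := n)).symm (e₂ (n := n)).symm M).toBlocks₂₂).map f :=
  ⟨rfl, rfl, rfl, rfl⟩

/-- ring homomorphisms preserve the Siegel relation. [cite: GelbartRogawski1991, §3.1 Prop. 3.1.1 p. 455 L1–2] -/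
theorem IsSiegelM.map {R S : Type*} [CommRing R] [CommRing S] (f : R →+* S)
    {M : Matrix (Fin (n + n)) (Fin (n + n)) R} (hM : IsSiegelM M) : IsSiegelM (M.map f) := by
  have h := toBlocks_reindex_e₂_map (n := n) (f : R → S) M
  unfold IsSiegelM at hM ⊢
  rw [h.1, h.2.1, h.2.2.1, h.2.2.2, ← Matrix.map_add (⇑f) (map_add f), ← Matrix.map_add (⇑f) (map_add f), hM]

/-- ring homomorphisms commute with `det_Δ`. [cite: GelbartRogawski1991, §3.1 Prop. 3.1.1 p. 455 L1–2] -/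
theorem map_detDeltaM {R S : Type*} [CommRing R] [CommRing S] (f : R →+* S)
    (M : Matrix (Fin (n + n)) (Fin (n + n)) R) : f (detDeltaM M) = detDeltaM (M.map f) := by
  have h := toBlocks_reindex_e₂_map (n := n) (f : R → S) M
  unfold detDeltaM
  rw [h.1, h.2.1, ← Matrix.map_add (⇑f) (map_add f), RingHom.map_det, RingHom.mapMatrix_apply]

/-- the identity matrix lies in `P_Δ` (`1₁₁ + 1₁₂ = 1 + 0 = 0 + 1 = 1₂₁ + 1₂₂`; cf. `one_apply_siegel`).
[cite: GelbartRogawski1991, §3.1 Prop. 3.1.1 p. 455 L1–2] -/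
theorem isSiegelM_one {R : Type*} [CommRing R] : IsSiegelM (1 : Matrix (Fin (n + n)) (Fin (n + n)) R) := by
  unfold IsSiegelM
  rw [Matrix.reindex_apply, Matrix.submatrix_one_equiv, ← Matrix.fromBlocks_one, Matrix.toBlocks_fromBlocks₁₁,
    Matrix.toBlocks_fromBlocks₁₂, Matrix.toBlocks_fromBlocks₂₁, Matrix.toBlocks_fromBlocks₂₂, add_zero, zero_add]

/-- `det_Δ 1 = 1`. [cite: GelbartRogawski1991, §3.1 Prop. 3.1.1 p. 455 L1–2] -/
theorem detDeltaM_one {R : Type*} [CommRing R] : detDeltaM (1 : Matrix (Fin (n + n)) (Fin (n + n)) R) = 1 := by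
  unfold detDeltaM
  rw [Matrix.reindex_apply, Matrix.submatrix_one_equiv, ← Matrix.fromBlocks_one, Matrix.toBlocks_fromBlocks₁₁,
    Matrix.toBlocks_fromBlocks₁₂, add_zero, Matrix.det_one]

/-- over a product ring the Siegel relation holds iff it holds in both components.
[cite: GelbartRogawski1991, §3.1 Prop. 3.1.1 p. 455 L1–2] -/
theorem isSiegelM_iff_fst_snd {R S : Type*} [CommRing R] [CommRing S]
    (M : Matrix (Fin (n + n)) (Fin (n + n)) (R × S)) :
    IsSiegelM M ↔ IsSiegelM (M.map (RingHom.fst R S)) ∧ IsSiegelM (M.map (RingHom.snd R S)) := by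
  refine ⟨fun h => ⟨h.map (n := n) _, h.map (n := n) _⟩, fun h => ?_⟩
  simp only [isSiegelM_iff_entry] at h ⊢
  exact fun i j => Prod.ext (h.1 i j) (h.2 i j)

omit [IsCMField L] in
/-- over `𝔸_L^∞` the Siegel relation holds iff it holds at every finite place `w` of `L`
(`AdelicGroupData.finiteAdeleEval L w : 𝔸_L^∞ →+* L_w`, `Matrix.finiteAdele_eq_iff_forall`).
[cite: GelbartRogawski1991, §3.1 Prop. 3.1.1 p. 455 L1–2] -/
theorem isSiegelM_iff_forall_place (M : Matrix (Fin (n + n)) (Fin (n + n)) (FiniteAdeleRing (𝓞 L) L)) :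
    IsSiegelM M ↔ ∀ w : HeightOneSpectrum (𝓞 L), IsSiegelM (M.map (AdelicGroupData.finiteAdeleEval L w)) := by
  refine ⟨fun h w => h.map (n := n) _, fun h => ?_⟩
  unfold IsSiegelM at h ⊢
  rw [Matrix.finiteAdele_eq_iff_forall]
  intro w
  have k := toBlocks_reindex_e₂_map (n := n) (AdelicGroupData.finiteAdeleEval L w : _ → w.adicCompletion L) M
  rw [Matrix.map_add _ (map_add _), Matrix.map_add _ (map_add _), ← k.1, ← k.2.1, ← k.2.2.1, ← k.2.2.2]
  exact h w

/-! ##### the matrix of `finAdelicToAdelic b`, `b ∈ H(𝔸_f)`: `(1, b)` entrywise (tree `GLn.coe_ofFinite_apply`) -/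

/-- the `(i,j)` entry of the matrix of `finAdelicToAdelic b` is `(1, b_{ij})`.
[cite: GelbartRogawski1991, §3.1 Prop. 3.1.1 p. 455 L1–2] -/
theorem coe_finAdelicToAdelic_apply (b : HAf) (i j : Fin (n + n)) :
    (((finToA b).1 : GL (Fin (n + n)) (AdeleRing (𝓞 L) L)) :
        Matrix (Fin (n + n)) (Fin (n + n)) (AdeleRing (𝓞 L) L)) i j =
      ((1 : Matrix (Fin (n + n)) (Fin (n + n)) (InfiniteAdeleRing L)) i j,
        ((b : GL (Fin (n + n)) (FiniteAdeleRing (𝓞 L) L)) : Matrix (Fin (n + n)) (Fin (n + n)) (FiniteAdeleRing (𝓞 L) L)) i j) := by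
  change (GLn.ofFinite (n + n) L (b : GL (Fin (n + n)) (FiniteAdeleRing (𝓞 L) L)) :
    Matrix _ _ (AdeleRing (𝓞 L) L)) i j = _
  rw [GLn.coe_ofFinite_apply]

/-- the archimedean component of the matrix of `finAdelicToAdelic b` is `1`.
[cite: GelbartRogawski1991, §3.1 Prop. 3.1.1 p. 455 L1–2] -/
theorem map_fst_coe_finAdelicToAdelic (b : HAf) :
    (((finToA b).1 : GL (Fin (n + n)) (AdeleRing (𝓞 L) L)) :
        Matrix (Fin (n + n)) (Fin (n + n)) (AdeleRing (𝓞 L) L)).map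
        (RingHom.fst (InfiniteAdeleRing L) (FiniteAdeleRing (𝓞 L) L)) = 1 :=
  Matrix.ext fun i j => congrArg Prod.fst (coe_finAdelicToAdelic_apply L e dV hdV dW hdW b i j)

/-- the finite component of the matrix of `finAdelicToAdelic b` is the matrix of `b`.
[cite: GelbartRogawski1991, §3.1 Prop. 3.1.1 p. 455 L1–2] -/
theorem map_snd_coe_finAdelicToAdelic (b : HAf) :
    (((finToA b).1 : GL (Fin (n + n)) (AdeleRing (𝓞 L) L)) :
        Matrix (Fin (n + n)) (Fin (n + n)) (AdeleRing (𝓞 L) L)).map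
        (RingHom.snd (InfiniteAdeleRing L) (FiniteAdeleRing (𝓞 L) L)) =
      ((b : GL (Fin (n + n)) (FiniteAdeleRing (𝓞 L) L)) : Matrix (Fin (n + n)) (Fin (n + n)) (FiniteAdeleRing (𝓞 L) L)) :=
  Matrix.ext fun i j => congrArg Prod.snd (coe_finAdelicToAdelic_apply L e dV hdV dW hdW b i j)

/-- `finAdelicToAdelic b ∈ P_Δ(𝔸) ↔` the matrix of `b` (over `𝔸_L^∞`) satisfies the Siegel relation
(product-ring lemmas are instantiated by `exact`, never `rw`: `AdeleRing` is a `def` over `L_∞ × 𝔸_L^∞`).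
[cite: GelbartRogawski1991, §3.1 Prop. 3.1.1 p. 455 L1–2] -/
theorem isSiegelDelta_finAdelicToAdelic_iff (b : HAf) :
    IsSiegelDelta L e dV hdV dW hdW (finToA b) ↔
      IsSiegelM ((b : GL (Fin (n + n)) (FiniteAdeleRing (𝓞 L) L)) : Matrix (Fin (n + n)) (Fin (n + n)) (FiniteAdeleRing (𝓞 L) L)) := by
  have h := isSiegelM_iff_fst_snd (n := n) (R := InfiniteAdeleRing L) (S := FiniteAdeleRing (𝓞 L) L)
    (((finToA b).1 : GL (Fin (n + n)) (AdeleRing (𝓞 L) L)) : Matrix (Fin (n + n)) (Fin (n + n)) (AdeleRing (𝓞 L) L))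
  refine h.trans ⟨fun k => (congrArg IsSiegelM (map_snd_coe_finAdelicToAdelic L e dV hdV dW hdW b)).mp k.2, fun k => ⟨?_, ?_⟩⟩
  · exact (congrArg IsSiegelM (map_fst_coe_finAdelicToAdelic L e dV hdV dW hdW b)).mpr isSiegelM_one
  · exact (congrArg IsSiegelM (map_snd_coe_finAdelicToAdelic L e dV hdV dW hdW b)).mpr k

/-- `(det_Δ (finAdelicToAdelic b)).1 = 1`. [cite: GelbartRogawski1991, §3.1 Prop. 3.1.1 p. 455 L1–2] -/
theorem fst_detDelta_finAdelicToAdelic (b : HAf) : (detDelta L e dV hdV dW hdW (finToA b)).1 = 1 :=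
  (map_detDeltaM (RingHom.fst (InfiniteAdeleRing L) (FiniteAdeleRing (𝓞 L) L))
    (((finToA b).1 : GL (Fin (n + n)) (AdeleRing (𝓞 L) L)) : Matrix (Fin (n + n)) (Fin (n + n)) (AdeleRing (𝓞 L) L))).trans
    ((congrArg detDeltaM (map_fst_coe_finAdelicToAdelic L e dV hdV dW hdW b)).trans detDeltaM_one)

/-- `(det_Δ (finAdelicToAdelic b)).2 = det_Δ (matrix of b)`.
[cite: GelbartRogawski1991, §3.1 Prop. 3.1.1 p. 455 L1–2] -/
theorem snd_detDelta_finAdelicToAdelic (b : HAf) :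
    (detDelta L e dV hdV dW hdW (finToA b)).2 =
      detDeltaM ((b : GL (Fin (n + n)) (FiniteAdeleRing (𝓞 L) L)) : Matrix (Fin (n + n)) (Fin (n + n)) (FiniteAdeleRing (𝓞 L) L)) :=
  (map_detDeltaM (RingHom.snd (InfiniteAdeleRing L) (FiniteAdeleRing (𝓞 L) L))
    (((finToA b).1 : GL (Fin (n + n)) (AdeleRing (𝓞 L) L)) : Matrix (Fin (n + n)) (Fin (n + n)) (AdeleRing (𝓞 L) L))).trans
    (congrArg detDeltaM (map_snd_coe_finAdelicToAdelic L e dV hdV dW hdW b))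

/-- `(det_Δ (finAdelicToAdelic b)).2 w = det_Δ (matrix of b_w)` (`GLn.evalAt`, tree `map_eval_eq_evalAt`).
[cite: GelbartRogawski1991, §3.1 Prop. 3.1.1 p. 455 L1–2] -/
theorem snd_detDelta_finAdelicToAdelic_apply (b : HAf) (w : HeightOneSpectrum (𝓞 L)) :
    (detDelta L e dV hdV dW hdW (finToA b)).2 w =
      detDeltaM ((GLn.evalAt (n + n) L w (b : GL (Fin (n + n)) (FiniteAdeleRing (𝓞 L) L)) :
        Matrix (Fin (n + n)) (Fin (n + n)) (w.adicCompletion L))) := by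
  rw [snd_detDelta_finAdelicToAdelic]
  change AdelicGroupData.finiteAdeleEval L w (detDeltaM _) = _
  rw [map_detDeltaM, UnitaryGroup.map_eval_eq_evalAt]

section PlaceComponentsLocal

variable (v : HeightOneSpectrum (𝓞 (Fp L)))

/-! ##### `ι_v u = locToAdelic v u = finAdelicToAdelic (inclPlace v u)` -/

/-- `locToAdelic v u = finAdelicToAdelic (inclPlace v u)` (`UnitaryGroup.inclPlaceAdelic_apply`, `rfl`).
[cite: GelbartRogawski1991, §3.1 Prop. 3.1.1 p. 455 L1–2] -/
theorem locToAdelic_eq_finAdelicToAdelic_inclPlace (u : LocPi v) :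
    locToAdelic L e dV hdV dW hdW v u = finToA (inclP v u) := rfl

/-- the `w`-component of `inclPlace v u` is `u_w` for `w ∣ v` …
[cite: GelbartRogawski1991, §3.1 Prop. 3.1.1 p. 455 L1–2] -/
theorem coe_evalAt_inclPlace_of_over (u : LocPi v) (w : UnitaryGroup.PlacesOver L v) :
    ((GLn.evalAt (n + n) L w.1 ((inclP v u : HAf) : GL (Fin (n + n)) (FiniteAdeleRing (𝓞 L) L))) :
        Matrix (Fin (n + n)) (Fin (n + n)) (w.1.adicCompletion L)) =
      ((((u : LocPi v) : LocGLPi v) w : GL (Fin (n + n)) (w.1.adicCompletion L)) :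
        Matrix (Fin (n + n)) (Fin (n + n)) (w.1.adicCompletion L)) := by
  rw [UnitaryGroup.evalAt_inclPlace_of_over]

/-- … and `1` for `w ∤ v`. [cite: GelbartRogawski1991, §3.1 Prop. 3.1.1 p. 455 L1–2] -/
theorem coe_evalAt_inclPlace_of_not_over (u : LocPi v) (w : HeightOneSpectrum (𝓞 L)) (h : w.under (𝓞 (Fp L)) ≠ v) :
    ((GLn.evalAt (n + n) L w ((inclP v u : HAf) : GL (Fin (n + n)) (FiniteAdeleRing (𝓞 L) L))) :
        Matrix (Fin (n + n)) (Fin (n + n)) (w.adicCompletion L)) = 1 := by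
  rw [UnitaryGroup.evalAt_inclPlace_of_not_over (Fp L) L (IsCMField.complexConj L) (n + n) (hermD L e dV hdV dW hdW) h u ⟨w, rfl⟩]
  rfl

/-- **`ι_v u ∈ P_Δ(𝔸) ↔ u_w ∈ P_Δ(L_w)` for every `w ∣ v`** (Siegel relation of the local matrix).
[cite: GelbartRogawski1991, §3.1 Prop. 3.1.1 p. 455 L1–2] -/
theorem isSiegelDelta_locToAdelic_iff (u : LocPi v) :
    IsSiegelDelta L e dV hdV dW hdW (locToAdelic L e dV hdV dW hdW v u) ↔
      ∀ w : UnitaryGroup.PlacesOver L v,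
        IsSiegelM ((((u : LocPi v) : LocGLPi v) w : GL (Fin (n + n)) (w.1.adicCompletion L)) :
          Matrix (Fin (n + n)) (Fin (n + n)) (w.1.adicCompletion L)) := by
  rw [locToAdelic_eq_finAdelicToAdelic_inclPlace, isSiegelDelta_finAdelicToAdelic_iff, isSiegelM_iff_forall_place]
  refine ⟨fun h w => ?_, fun h w => ?_⟩
  · have hw := h w.1
    rwa [UnitaryGroup.map_eval_eq_evalAt, coe_evalAt_inclPlace_of_over] at hw
  · rw [UnitaryGroup.map_eval_eq_evalAt]
    by_cases hv : w.under (𝓞 (Fp L)) = v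
    · rw [coe_evalAt_inclPlace_of_over L e dV hdV dW hdW v u ⟨w, hv⟩]
      exact h ⟨w, hv⟩
    · rw [coe_evalAt_inclPlace_of_not_over L e dV hdV dW hdW v u w hv]
      exact isSiegelM_one

/-- `(det_Δ ι_v u).1 = 1` (trivial archimedean component).
[cite: GelbartRogawski1991, §3.1 Prop. 3.1.1 p. 455 L1–2] -/
theorem fst_detDelta_locToAdelic (u : LocPi v) : (detDelta L e dV hdV dW hdW (locToAdelic L e dV hdV dW hdW v u)).1 = 1 :=
  fst_detDelta_finAdelicToAdelic L e dV hdV dW hdW _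

/-- `(det_Δ ι_v u).2 w = det_Δ(u_w)` for `w ∣ v` (`= UnitaryDualPair.LocalSplitting.detDelta … w u`, `rfl`).
[cite: GelbartRogawski1991, §3.1 Prop. 3.1.1 p. 455 L1–2] -/
theorem snd_detDelta_locToAdelic_of_over (u : LocPi v) (w : UnitaryGroup.PlacesOver L v) :
    (detDelta L e dV hdV dW hdW (locToAdelic L e dV hdV dW hdW v u)).2 w.1 =
      detDeltaM ((((u : LocPi v) : LocGLPi v) w : GL (Fin (n + n)) (w.1.adicCompletion L)) :
        Matrix (Fin (n + n)) (Fin (n + n)) (w.1.adicCompletion L)) := by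
  rw [locToAdelic_eq_finAdelicToAdelic_inclPlace, snd_detDelta_finAdelicToAdelic_apply, coe_evalAt_inclPlace_of_over]

/-- `(det_Δ ι_v u).2 w = 1` for `w ∤ v`. [cite: GelbartRogawski1991, §3.1 Prop. 3.1.1 p. 455 L1–2] -/
theorem snd_detDelta_locToAdelic_of_not_over (u : LocPi v) (w : HeightOneSpectrum (𝓞 L)) (h : w.under (𝓞 (Fp L)) ≠ v) :
    (detDelta L e dV hdV dW hdW (locToAdelic L e dV hdV dW hdW v u)).2 w = 1 := by
  rw [locToAdelic_eq_finAdelicToAdelic_inclPlace, snd_detDelta_finAdelicToAdelic_apply,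
    coe_evalAt_inclPlace_of_not_over L e dV hdV dW hdW v u w h, detDeltaM_one]

/-- both cases at once. [cite: GelbartRogawski1991, §3.1 Prop. 3.1.1 p. 455 L1–2] -/
theorem snd_detDelta_locToAdelic_apply (u : LocPi v) (w : HeightOneSpectrum (𝓞 L)) :
    (detDelta L e dV hdV dW hdW (locToAdelic L e dV hdV dW hdW v u)).2 w =
      if h : w.under (𝓞 (Fp L)) = v then
        detDeltaM ((((u : LocPi v) : LocGLPi v) ⟨w, h⟩ : GL (Fin (n + n)) (w.adicCompletion L)) :
          Matrix (Fin (n + n)) (Fin (n + n)) (w.adicCompletion L))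
      else 1 := by
  split_ifs with h
  · exact snd_detDelta_locToAdelic_of_over L e dV hdV dW hdW v u ⟨w, h⟩
  · exact snd_detDelta_locToAdelic_of_not_over L e dV hdV dW hdW v u w h

/-- units, forward: `det_Δ(ι_v u) ∈ 𝔸_L^× ⇒ det_Δ(u_w) ∈ L_w^×` for `w ∣ v`.
[cite: GelbartRogawski1991, §3.1 Prop. 3.1.1 p. 455 L1–2] -/
theorem isUnit_detDeltaM_of_isUnit_detDelta_locToAdelic (u : LocPi v)
    (hu : IsUnit (detDelta L e dV hdV dW hdW (locToAdelic L e dV hdV dW hdW v u))) (w : UnitaryGroup.PlacesOver L v) :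
    IsUnit (detDeltaM ((((u : LocPi v) : LocGLPi v) w : GL (Fin (n + n)) (w.1.adicCompletion L)) :
        Matrix (Fin (n + n)) (Fin (n + n)) (w.1.adicCompletion L))) := by
  rw [← snd_detDelta_locToAdelic_of_over]
  have hu' : IsUnit ((detDelta L e dV hdV dW hdW (locToAdelic L e dV hdV dW hdW v u) : AdeleRing (𝓞 L) L) :
      InfiniteAdeleRing L × FiniteAdeleRing (𝓞 L) L) := hu
  exact (hu'.map (RingHom.snd (InfiniteAdeleRing L) (FiniteAdeleRing (𝓞 L) L))).map
    (AdelicGroupData.finiteAdeleEval L w.1)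

/-! ##### `det_Δ(ι_v u)` as an idele, `χ(det_Δ(ι_v u))`, `|det_Δ(ι_v u)|^{1/2}` -/

omit [IsCMField L] in
/-- finite components of a finite product of ideles (cf. `Automorphic.ideleGroup_val_snd_prod`, not in this import closure).
[cite: GelbartRogawski1991, §3.1 Prop. 3.1.1 p. 455 L1–2] -/
theorem ideleGroup_val_snd_prod' {ι : Type*} (s : Finset ι) (f : ι → ideleGroup L) (w : HeightOneSpectrum (𝓞 L)) :
    (((∏ i ∈ s, f i : ideleGroup L)) : AdeleRing (𝓞 L) L).2 w = ∏ i ∈ s, ((f i : ideleGroup L) : AdeleRing (𝓞 L) L).2 w := by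
  induction s using Finset.induction_on with
  | empty => rfl
  | insert a s ha ih => rw [Finset.prod_insert ha, Finset.prod_insert ha, ideleGroup_val_snd_mul, ih]

omit [IsCMField L] in
/-- infinite component of a finite product of ideles. [cite: GelbartRogawski1991, §3.1 Prop. 3.1.1 p. 455 L1–2] -/
theorem ideleGroup_val_fst_prod' {ι : Type*} (s : Finset ι) (f : ι → ideleGroup L) :
    (((∏ i ∈ s, f i : ideleGroup L)) : AdeleRing (𝓞 L) L).1 = ∏ i ∈ s, ((f i : ideleGroup L) : AdeleRing (𝓞 L) L).1 := by
  rw [← ideleGroup.infComp_apply, map_prod]; rfl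

/-- `‖⟨x⟩_w‖ = ‖x‖_w` (cf. `GaloisRepresentations.ideleNorm_localUnits`, not in this import closure).
[cite: GelbartRogawski1991, §3.1 Prop. 3.1.1 p. 455 L1–2] -/
theorem ideleNorm_localUnits' (w : HeightOneSpectrum (𝓞 L)) (x : (w.adicCompletion L)ˣ) :
    ideleNorm (localUnits w x) = ‖(x : w.adicCompletion L)‖ := by
  unfold ideleNorm
  rw [finprod_eq_single _ w fun w' hw' => by
      rw [show ((localUnits w x : ideleGroup L) : AdeleRing (𝓞 L) L).2 w' = 1 from
        finiteAdeleSingle_apply_of_ne _ hw', norm_one]]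
  simp [show ∀ w' : InfinitePlace L, (1 : InfiniteAdeleRing L) w' = 1 from fun _ => rfl]

/-- `‖∏_{w ∣ v} ⟨x_w⟩_w‖ = ∏_{w ∣ v} ‖x_w‖_w` (multiplicativity `Automorphic.ideleNorm_mul`, `rfl`-compatible with Tate's real norm).
[cite: GelbartRogawski1991, §3.1 Prop. 3.1.1 p. 455 L1–2] -/
theorem ideleNorm_prod_localUnits (x : ∀ w : UnitaryGroup.PlacesOver L v, (w.1.adicCompletion L)ˣ) :
    ideleNorm (∏ w : UnitaryGroup.PlacesOver L v, localUnits w.1 (x w)) =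
      ∏ w : UnitaryGroup.PlacesOver L v, ‖(x w : w.1.adicCompletion L)‖ := by
  have key : ∀ s : Finset (UnitaryGroup.PlacesOver L v),
      ideleNorm (∏ w ∈ s, localUnits w.1 (x w)) = ∏ w ∈ s, ‖(x w : w.1.adicCompletion L)‖ := by
    intro s
    induction s using Finset.induction_on with
    | empty => rw [Finset.prod_empty, Finset.prod_empty]; exact ideleNorm_one ..
    | insert a s ha ih =>
      rw [Finset.prod_insert ha, Finset.prod_insert ha, ← ih, ← ideleNorm_localUnits' (L := L) a.1 (x a)]
      exact ideleNorm_mul ..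
  exact key Finset.univ

/-- the idele `∏_{w ∣ v} ⟨det_Δ(u_w)⟩_w`, for `u ∈ H(L⁺_v)` with every `det_Δ(u_w)` a unit.
[cite: GelbartRogawski1991, §3.1 Prop. 3.1.1 p. 455 L1–2] -/
def detDeltaIdele (u : LocPi v)
    (hloc : ∀ w : UnitaryGroup.PlacesOver L v,
      IsUnit (detDeltaM ((((u : LocPi v) : LocGLPi v) w : GL (Fin (n + n)) (w.1.adicCompletion L)) :
        Matrix (Fin (n + n)) (Fin (n + n)) (w.1.adicCompletion L)))) : ideleGroup L :=
  ∏ w : UnitaryGroup.PlacesOver L v, localUnits w.1 (hloc w).unit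

/-- the archimedean component of `detDeltaIdele` is `1`. [cite: GelbartRogawski1991, §3.1 Prop. 3.1.1 p. 455 L1–2] -/
theorem detDeltaIdele_val_fst (u : LocPi v)
    (hloc : ∀ w : UnitaryGroup.PlacesOver L v,
      IsUnit (detDeltaM ((((u : LocPi v) : LocGLPi v) w : GL (Fin (n + n)) (w.1.adicCompletion L)) :
        Matrix (Fin (n + n)) (Fin (n + n)) (w.1.adicCompletion L)))) :
    ((detDeltaIdele L e dV hdV dW hdW v u hloc : ideleGroup L) : AdeleRing (𝓞 L) L).1 = 1 := by
  unfold detDeltaIdele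
  rw [ideleGroup_val_fst_prod']
  exact Finset.prod_eq_one fun w _ => rfl

/-- the finite components of `detDeltaIdele`: `det_Δ(u_w)` above `v`, `1` elsewhere.
[cite: GelbartRogawski1991, §3.1 Prop. 3.1.1 p. 455 L1–2] -/
theorem detDeltaIdele_val_snd (u : LocPi v)
    (hloc : ∀ w : UnitaryGroup.PlacesOver L v,
      IsUnit (detDeltaM ((((u : LocPi v) : LocGLPi v) w : GL (Fin (n + n)) (w.1.adicCompletion L)) :
        Matrix (Fin (n + n)) (Fin (n + n)) (w.1.adicCompletion L)))) (w : HeightOneSpectrum (𝓞 L)) :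
    ((detDeltaIdele L e dV hdV dW hdW v u hloc : ideleGroup L) : AdeleRing (𝓞 L) L).2 w =
      if h : w.under (𝓞 (Fp L)) = v then
        detDeltaM ((((u : LocPi v) : LocGLPi v) ⟨w, h⟩ : GL (Fin (n + n)) (w.adicCompletion L)) :
          Matrix (Fin (n + n)) (Fin (n + n)) (w.adicCompletion L))
      else 1 := by
  unfold detDeltaIdele
  rw [ideleGroup_val_snd_prod']
  split_ifs with h
  · rw [Finset.prod_eq_single_of_mem (⟨w, h⟩ : UnitaryGroup.PlacesOver L v) (Finset.mem_univ _) fun w' _ hw' =>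
      localUnits_snd_apply_of_ne _ fun e => hw' (Subtype.ext e.symm)]
    exact (localUnits_snd_apply_self _ _).trans (hloc ⟨w, h⟩).unit_spec
  · exact Finset.prod_eq_one fun w' _ => localUnits_snd_apply_of_ne _ fun e => h (by rw [e]; exact w'.2)

/-- **`det_Δ(ι_v u) = ∏_{w ∣ v} ⟨det_Δ(u_w)⟩_w`** in `𝔸_L`.
[cite: GelbartRogawski1991, §3.1 Prop. 3.1.1 p. 455 L1–2] -/
theorem detDelta_locToAdelic_eq_detDeltaIdele (u : LocPi v)
    (hloc : ∀ w : UnitaryGroup.PlacesOver L v,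
      IsUnit (detDeltaM ((((u : LocPi v) : LocGLPi v) w : GL (Fin (n + n)) (w.1.adicCompletion L)) :
        Matrix (Fin (n + n)) (Fin (n + n)) (w.1.adicCompletion L)))) :
    detDelta L e dV hdV dW hdW (locToAdelic L e dV hdV dW hdW v u) = ((detDeltaIdele L e dV hdV dW hdW v u hloc : ideleGroup L) : AdeleRing (𝓞 L) L) :=
  Prod.ext ((fst_detDelta_locToAdelic L e dV hdV dW hdW v u).trans (detDeltaIdele_val_fst L e dV hdV dW hdW v u hloc).symm)
    (FiniteAdeleRing.ext L fun w =>
      (snd_detDelta_locToAdelic_apply L e dV hdV dW hdW v u w).trans (detDeltaIdele_val_snd L e dV hdV dW hdW v u hloc w).symm)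

/-- **units: `det_Δ(ι_v u) ∈ 𝔸_L^× ↔ det_Δ(u_w) ∈ L_w^×` for all `w ∣ v`.**
[cite: GelbartRogawski1991, §3.1 Prop. 3.1.1 p. 455 L1–2] -/
theorem isUnit_detDelta_locToAdelic_iff (u : LocPi v) :
    IsUnit (detDelta L e dV hdV dW hdW (locToAdelic L e dV hdV dW hdW v u)) ↔
      ∀ w : UnitaryGroup.PlacesOver L v,
        IsUnit (detDeltaM ((((u : LocPi v) : LocGLPi v) w : GL (Fin (n + n)) (w.1.adicCompletion L)) :
          Matrix (Fin (n + n)) (Fin (n + n)) (w.1.adicCompletion L))) :=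
  ⟨fun hu w => isUnit_detDeltaM_of_isUnit_detDelta_locToAdelic L e dV hdV dW hdW v u hu w,
    fun hloc => ⟨detDeltaIdele L e dV hdV dW hdW v u hloc, (detDelta_locToAdelic_eq_detDeltaIdele L e dV hdV dW hdW v u hloc).symm⟩⟩

/-- the unit `det_Δ(ι_v u)` IS the idele `∏_{w ∣ v} ⟨det_Δ(u_w)⟩_w`.
[cite: GelbartRogawski1991, §3.1 Prop. 3.1.1 p. 455 L1–2] -/
theorem unit_detDelta_locToAdelic (u : LocPi v)
    (hloc : ∀ w : UnitaryGroup.PlacesOver L v,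
      IsUnit (detDeltaM ((((u : LocPi v) : LocGLPi v) w : GL (Fin (n + n)) (w.1.adicCompletion L)) :
        Matrix (Fin (n + n)) (Fin (n + n)) (w.1.adicCompletion L))))
    (hu : IsUnit (detDelta L e dV hdV dW hdW (locToAdelic L e dV hdV dW hdW v u))) :
    hu.unit = detDeltaIdele L e dV hdV dW hdW v u hloc :=
  Units.ext (hu.unit_spec.trans (detDelta_locToAdelic_eq_detDeltaIdele L e dV hdV dW hdW v u hloc))

/-- **`χ(det_Δ(ι_v u)) = ∏_{w ∣ v} χ_w(det_Δ(u_w))`**, `χ_w = HeckeCharacter.localComponent χ w = χ ∘ localUnits w`.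
[cite: GelbartRogawski1991, §3.1 Prop. 3.1.1 p. 455 L1–2] -/
theorem chiDet_locToAdelic (χ : HeckeCharacter L) (u : LocPi v)
    (hloc : ∀ w : UnitaryGroup.PlacesOver L v,
      IsUnit (detDeltaM ((((u : LocPi v) : LocGLPi v) w : GL (Fin (n + n)) (w.1.adicCompletion L)) :
        Matrix (Fin (n + n)) (Fin (n + n)) (w.1.adicCompletion L)))) :
    chiDet L e dV hdV dW hdW χ (locToAdelic L e dV hdV dW hdW v u) =
      ∏ w : UnitaryGroup.PlacesOver L v, χ.localComponent w.1 (hloc w).unit := by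
  have hu : IsUnit (detDelta L e dV hdV dW hdW (locToAdelic L e dV hdV dW hdW v u)) := (isUnit_detDelta_locToAdelic_iff L e dV hdV dW hdW v u).2 hloc
  unfold chiDet
  rw [dif_pos hu, unit_detDelta_locToAdelic L e dV hdV dW hdW v u hloc hu]
  unfold detDeltaIdele
  rw [map_prod]
  rfl

/-- the same with the right-hand side in the local package's shape: `∏_{w ∣ v} (χ_w(det_Δ u_w) if unit, else 1)` — this product IS
`UnitaryDualPair.LocalSplitting.chiDet F L c v n (fun w => χ.localComponent w.1) u` (`LocalDoubledUnitaryDatum`, `rfl`).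
[cite: GelbartRogawski1991, §3.1 Prop. 3.1.1 p. 455 L1–2] -/
theorem chiDet_locToAdelic_eq_prod_dite (χ : HeckeCharacter L) (u : LocPi v)
    (hloc : ∀ w : UnitaryGroup.PlacesOver L v,
      IsUnit (detDeltaM ((((u : LocPi v) : LocGLPi v) w : GL (Fin (n + n)) (w.1.adicCompletion L)) :
        Matrix (Fin (n + n)) (Fin (n + n)) (w.1.adicCompletion L)))) :
    chiDet L e dV hdV dW hdW χ (locToAdelic L e dV hdV dW hdW v u) =
      ∏ w : UnitaryGroup.PlacesOver L v,
        if hu : IsUnit (detDeltaM ((((u : LocPi v) : LocGLPi v) w : GL (Fin (n + n)) (w.1.adicCompletion L)) :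
            Matrix (Fin (n + n)) (Fin (n + n)) (w.1.adicCompletion L))) then χ.localComponent w.1 hu.unit else 1 := by
  rw [chiDet_locToAdelic L e dV hdV dW hdW v χ u hloc]
  exact Finset.prod_congr rfl fun w _ => by rw [dif_pos (hloc w)]

/-- … and `χ(det_Δ(ι_v u)) = 1` as soon as one `det_Δ(u_w)` is a non-unit.
[cite: GelbartRogawski1991, §3.1 Prop. 3.1.1 p. 455 L1–2] -/
theorem chiDet_locToAdelic_of_not_isUnit (χ : HeckeCharacter L) (u : LocPi v) (w : UnitaryGroup.PlacesOver L v)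
    (hw : ¬ IsUnit (detDeltaM ((((u : LocPi v) : LocGLPi v) w : GL (Fin (n + n)) (w.1.adicCompletion L)) :
          Matrix (Fin (n + n)) (Fin (n + n)) (w.1.adicCompletion L)))) :
    chiDet L e dV hdV dW hdW χ (locToAdelic L e dV hdV dW hdW v u) = 1 := by
  unfold chiDet
  rw [dif_neg fun hu => hw (isUnit_detDeltaM_of_isUnit_detDelta_locToAdelic L e dV hdV dW hdW v u hu w)]

/-- **`|det_Δ(ι_v u)|_𝔸^{1/2} = ∏_{w ∣ v} ‖det_Δ(u_w)‖_w^{1/2}`** when every `det_Δ(u_w)` is a unit.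
[cite: GelbartRogawski1991, §3.1 Prop. 3.1.1 p. 455 L1–2] -/
theorem modDelta_locToAdelic (u : LocPi v)
    (hloc : ∀ w : UnitaryGroup.PlacesOver L v,
      IsUnit (detDeltaM ((((u : LocPi v) : LocGLPi v) w : GL (Fin (n + n)) (w.1.adicCompletion L)) :
        Matrix (Fin (n + n)) (Fin (n + n)) (w.1.adicCompletion L)))) :
    modDelta L e dV hdV dW hdW (locToAdelic L e dV hdV dW hdW v u) =
      ∏ w : UnitaryGroup.PlacesOver L v,
        Real.sqrt ‖detDeltaM ((((u : LocPi v) : LocGLPi v) w : GL (Fin (n + n)) (w.1.adicCompletion L)) :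
          Matrix (Fin (n + n)) (Fin (n + n)) (w.1.adicCompletion L))‖ := by
  have hu : IsUnit (detDelta L e dV hdV dW hdW (locToAdelic L e dV hdV dW hdW v u)) := (isUnit_detDelta_locToAdelic_iff L e dV hdV dW hdW v u).2 hloc
  unfold modDelta
  rw [dif_pos hu, unit_detDelta_locToAdelic L e dV hdV dW hdW v u hloc hu]
  unfold detDeltaIdele
  rw [ideleNorm_prod_localUnits, Real.sqrt_eq_iff_eq_sq (Finset.prod_nonneg fun _ _ => norm_nonneg _)
    (Finset.prod_nonneg fun _ _ => Real.sqrt_nonneg _), ← Finset.prod_pow]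
  exact Finset.prod_congr rfl fun w _ => by rw [IsUnit.unit_spec, Real.sq_sqrt (norm_nonneg _)]

/-- … and `|det_Δ(ι_v u)|^{1/2} = 1` as soon as one `det_Δ(u_w)` is a non-unit.
[cite: GelbartRogawski1991, §3.1 Prop. 3.1.1 p. 455 L1–2] -/
theorem modDelta_locToAdelic_of_not_isUnit (u : LocPi v) (w : UnitaryGroup.PlacesOver L v)
    (hw : ¬ IsUnit (detDeltaM ((((u : LocPi v) : LocGLPi v) w : GL (Fin (n + n)) (w.1.adicCompletion L)) :
          Matrix (Fin (n + n)) (Fin (n + n)) (w.1.adicCompletion L)))) :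
    modDelta L e dV hdV dW hdW (locToAdelic L e dV hdV dW hdW v u) = 1 := by
  unfold modDelta
  rw [dif_neg fun hu => hw (isUnit_detDeltaM_of_isUnit_detDelta_locToAdelic L e dV hdV dW hdW v u hu w)]

end PlaceComponentsLocal

end PlaceComponents

end Literature.NumberTheory.GelbartRogawski1991.GRConstruction
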